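import Summits.Ventures.PercRepro.PassSchemeTree
import Summits.Ventures.PercRepro.C026Hall

/-!
# The census-witness form implies C6-HALL: `c6Hall_of_c6Complete` (p5, gen 7)

A complete run of mine-3's pass-major request list (`C6Complete es`) yields the injection of C6-HALL:
the run's assignment is injective by construction (`PassScheme.inv_run`); the first tree pass claims
`τ₅₀ x` for every `x ∈ BotM ∧ O1` and the second claims `τ₁₈ x` for every `x ∈ BotM ∧ O2 ∧ ¬O1`
(the canonical-pass theorem `mem_fst_foldl_treeRequests_iff`), so every target taken later by a
residual configuration is free; the residual's targets come from the edge-adding passes, hence are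
supersets in a pair cell.

* `PassScheme.mem_pair_of_served` — a source served by a tree pass carries its image in the state;
* `PassScheme.subset_foldl` — the state only grows; `PassScheme.fst_eq_of_nodup_snd` — distinct targets;
* **`c6Hall_of_c6Complete`** and **`C6HallSimpleUpTo_of_c6Complete`**.
-/

namespace PercRepro

namespace PassScheme

variable {α : Type*} [DecidableEq α]

/-- The state only grows along a fold. -/
theorem subset_foldl (rs : List (α × List α)) (st : List (α × α)) : st ⊆ rs.foldl step st := by
  induction rs generalizing st with
  | nil => exact fun _ h => h
  | cons r rs ih =>
    refine fun p hp => ih (step st r) ?_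
    unfold step
    split_ifs
    · exact hp
    · split
      · exact hp
      · exact List.mem_cons_of_mem _ hp

/-- Along a tree pass, a newly served source carries its image. -/
theorem mem_pair_of_served {f : α → α} {cell : α → Prop} [DecidablePred cell] (xs : List α)
    {st₀ : List (α × α)} {x : α} (hx : x ∈ ((treeRequests f cell xs).foldl step st₀).map Prod.fst)
    (hx₀ : x ∉ st₀.map Prod.fst) : (x, f x) ∈ (treeRequests f cell xs).foldl step st₀ := by
  -- the invariant: a served source not served at the start carries its image
  suffices key : ∀ (ys : List α) (st : List (α × α)),
      (∀ y ∈ st.map Prod.fst, y ∉ st₀.map Prod.fst → (y, f y) ∈ st) →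
      ∀ y ∈ ((treeRequests f cell ys).foldl step st).map Prod.fst, y ∉ st₀.map Prod.fst →
        (y, f y) ∈ (treeRequests f cell ys).foldl step st from
    key xs st₀ (fun y hy hy₀ => absurd hy hy₀) x hx hx₀
  intro ys
  induction ys with
  | nil => exact fun st h y hy hy₀ => h y hy hy₀
  | cons z zs ih =>
    intro st h
    simp only [treeRequests, List.map_cons, List.foldl_cons]
    refine ih (step st (z, treeCand f cell z)) ?_
    intro y hy hy₀
    unfold step at hy ⊢
    split_ifs at hy ⊢ with hz
    · exact h y hy hy₀
    · rcases hpick : pick (st.map Prod.snd) (treeCand f cell z) with _ | t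
      · rw [hpick] at hy
        exact h y hy hy₀
      · rw [hpick] at hy
        rw [List.map_cons, List.mem_cons] at hy
        rcases hy with rfl | hy
        · obtain ⟨htc, _⟩ := pick_some hpick
          obtain ⟨rfl, _⟩ := mem_treeCand.mp htc
          exact List.mem_cons_self ..
        · exact List.mem_cons_of_mem _ (h y hy hy₀)

omit [DecidableEq α] in
/-- Two assignments with the same target are the same assignment (distinct claimed targets). -/
theorem fst_eq_of_nodup_snd {st : List (α × α)} (h : (st.map Prod.snd).Nodup) {p q : α × α}
    (hp : p ∈ st) (hq : q ∈ st) (he : p.2 = q.2) : p.1 = q.1 := by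
  have := List.inj_on_of_nodup_map h hp hq he
  rw [this]

end PassScheme

namespace MultiGraph

variable {V E : Type*} (G : MultiGraph V E) [Fintype E] [DecidableEq E]

open Classical in
/-- **The census-witness form gives C6-HALL.** -/
theorem c6Hall_of_c6Complete {es : List E} {a b c : V} (h : G.C6Complete es a b c) :
    G.C6Hall a b c := by
  obtain ⟨xs, hxs, hcomp⟩ := h
  -- the classical decidability of the cells, as used by `treePass`
  letI instAC : DecidablePred fun T : Config E => G.CellAC T a b c := fun _ => Classical.propDecidable _
  letI instBC : DecidablePred fun T : Config E => G.CellBC T a b c := fun _ => Classical.propDecidable _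
  -- the run and its invariant (candidates come from the passes)
  set rs := PassScheme.requests xs (G.c6Passes es a b c) with hrs
  have hinv := PassScheme.inv_run (ok := fun x t => ∃ cand ∈ G.c6Passes es a b c, t ∈ cand x) rs
    (by
      intro r hr t ht
      rw [PassScheme.mem_requests] at hr
      obtain ⟨cand, hc, x, _, rfl⟩ := hr
      exact ⟨cand, hc, ht⟩)
  -- the requests pass by pass, and the state after the two tree passes as prefixes of the run
  have hsplit : PassScheme.requests xs (G.c6Passes es a b c) =
      PassScheme.treeRequests (G.kSwapSealed c b) (fun T => G.CellAC T a b c) xs ++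
        (PassScheme.treeRequests (G.kSwapSealed c a) (fun T => G.CellBC T a b c) xs ++
          (xs.map (fun x => (x, G.oneEdgePassOrd (c6Cand1 es) a b c x)) ++
            xs.map fun x => (x, G.twoEdgePassOrd (c6Cand2 es) a b c x))) := by
    simp only [PassScheme.requests, c6Passes, List.flatMap_cons, List.flatMap_nil, List.append_nil]
    rfl
  set st₁ := (PassScheme.treeRequests (G.kSwapSealed c b) (fun T => G.CellAC T a b c) xs).foldl
    PassScheme.step [] with hst₁
  set st₂ := (PassScheme.treeRequests (G.kSwapSealed c a) (fun T => G.CellBC T a b c) xs).foldl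
    PassScheme.step st₁ with hst₂
  have hrun : PassScheme.run rs = _ := rfl
  have hst₁_sub : st₁ ⊆ PassScheme.run rs := by
    rw [PassScheme.run, hrs, hsplit, List.foldl_append, List.foldl_append]
    exact List.Subset.trans (PassScheme.subset_foldl _ _) (PassScheme.subset_foldl _ _)
  have hst₂_sub : st₂ ⊆ PassScheme.run rs := by
    rw [PassScheme.run, hrs, hsplit, List.foldl_append, List.foldl_append]
    exact PassScheme.subset_foldl _ _
  -- pass 1 serves every `BotM ∧ O1` with target `τ₅₀`
  have hpass1 : ∀ x, G.BotM x a b c → G.O1 x a b c → (x, G.kSwapSealed c b x) ∈ st₁ := by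
    intro x hx ho1
    have hxs : x ∈ xs := (hxs x).mpr hx
    have hserved : x ∈ st₁.map Prod.fst := by
      rw [hst₁]
      exact (PassScheme.mem_fst_foldl_treeRequests_iff (G.kSwapSealed_injective c b) xs [] hxs).mpr
        (Or.inr ⟨ho1.2, by simp⟩)
    exact PassScheme.mem_pair_of_served xs hserved (by simp)
  -- the claimed targets after pass 1 are `τ₅₀`-images in `ac|b`
  have hinv1 := PassScheme.treeInv_foldl (f := G.kSwapSealed c b) (cell := fun T => G.CellAC T a b c)
    xs (PassScheme.treeInv_refl _ _ [])
  -- pass 2 serves every `BotM ∧ O2 ∧ ¬O1` with target `τ₁₈`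
  have hpass2 : ∀ x, G.BotM x a b c → G.O2 x a b c → ¬ G.O1 x a b c →
      (x, G.kSwapSealed c a x) ∈ st₂ := by
    intro x hx ho2 hno1
    have hxs : x ∈ xs := (hxs x).mpr hx
    have hnot1 : x ∉ st₁.map Prod.fst := by
      intro hmem
      have := hinv1.new x hmem (by simp)
      exact hno1 ⟨hx.1, this.1⟩
    have hfree : G.kSwapSealed c a x ∉ st₁.map Prod.snd := by
      intro hmem
      rcases hinv1.snd _ hmem with h0 | ⟨y, hy, hy'⟩
      · simp at h0
      · have hcell := (hinv1.new y hy (by simp)).1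
        rw [← hy'] at hcell
        exact G.not_cellAC_and_cellBC hcell ho2.2
    have hserved : x ∈ st₂.map Prod.fst := by
      rw [hst₂]
      exact (PassScheme.mem_fst_foldl_treeRequests_iff (G.kSwapSealed_injective c a) xs st₁ hxs).mpr
        (Or.inr ⟨ho2.2, hfree⟩)
    exact PassScheme.mem_pair_of_served xs hserved hnot1
  -- the assignment of the run
  let f : Config E → Config E := fun ω =>
    if h : ∃ t, (ω, t) ∈ PassScheme.run rs then Classical.choose h else ω
  have hf : ∀ ω, G.KL ω a b c → (ω, f ω) ∈ PassScheme.run rs := by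
    intro ω hω
    have hxω : ω ∈ xs := (hxs ω).mpr hω.1
    have hserved := hcomp ω hxω
    rw [List.mem_map] at hserved
    obtain ⟨p, hp, hp1⟩ := hserved
    have hex : ∃ t, (ω, t) ∈ PassScheme.run rs := ⟨p.2, by rw [← hp1]; exact hp⟩
    simp only [f, dif_pos hex]
    exact Classical.choose_spec hex
  refine ⟨f, ?_, ?_⟩
  · -- injective on `KL`: distinct claimed targets
    intro ω hω ω' hω' heq
    exact PassScheme.fst_eq_of_nodup_snd hinv.nodup_snd (hf ω hω) (hf ω' hω') heq
  · intro ω hω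
    have hpair := hf ω hω
    obtain ⟨cand, hc, ht⟩ := hinv.ok _ hpair
    simp only at ht
    simp only [c6Passes, List.mem_cons, List.not_mem_nil, or_false] at hc
    -- the residual has no tree-pass candidate
    have hno1 : ¬ G.CellAC (G.kSwapSealed c b ω) a b c := fun h' => hω.2.1 ⟨hω.1.1, h'⟩
    have hno2 : ¬ G.CellBC (G.kSwapSealed c a ω) a b c := fun h' => hω.2.2 ⟨hω.1.1, h'⟩
    -- the target is a superset in a pair cell
    have hsup : ω ≤ f ω ∧ (G.CellAC (f ω) a b c ∨ G.CellBC (f ω) a b c) := by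
      rcases hc with rfl | rfl | rfl | rfl
      · exact absurd (mem_treePass.mp ht).2 (by rw [(mem_treePass.mp ht).1]; exact hno1)
      · exact absurd (mem_treePass.mp ht).2 (by rw [(mem_treePass.mp ht).1]; exact hno2)
      · refine ⟨?_, G.cell_of_mem_oneEdgePassOrd ht⟩
        unfold oneEdgePassOrd at ht
        rw [List.mem_filter, List.mem_map] at ht
        obtain ⟨⟨e, _, he⟩, _⟩ := ht
        rw [← he]
        exact le_update_true ω e
      · refine ⟨?_, G.cell_of_mem_twoEdgePassOrd ht⟩
        unfold twoEdgePassOrd at ht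
        rw [List.mem_filter, List.mem_map] at ht
        obtain ⟨⟨q, _, hq⟩, _⟩ := ht
        rw [← hq]
        exact (le_update_true ω q.1).trans (le_update_true _ q.2)
    refine ⟨hsup.1, ?_⟩
    rcases hsup.2 with hcell | hcell
    · refine Or.inl ⟨hcell, fun ω' hω' ho1 heq => ?_⟩
      have hp' := hst₁_sub (hpass1 ω' hω' ho1)
      have := PassScheme.fst_eq_of_nodup_snd hinv.nodup_snd hp' hpair heq
      simp only at this
      subst this
      exact hω.2.1 ho1
    · refine Or.inr ⟨hcell, fun ω' hω' ho2 hno1' heq => ?_⟩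
      have hp' := hst₂_sub (hpass2 ω' hω' ho2 hno1')
      have := PassScheme.fst_eq_of_nodup_snd hinv.nodup_snd hp' hpair heq
      simp only at this
      subst this
      exact hω.2.2 ho2

end MultiGraph

/-- **The census-witness form on the simple graphs with ≤ N vertices gives C6-HALL there.** -/
theorem C6HallSimpleUpTo_of_c6Complete {N : ℕ} (h : C6CompleteSimpleUpTo N) : C6HallSimpleUpTo N :=
  fun hV G hs a b c hab hac hbc =>
    let ⟨_, hes⟩ := h hV G hs a b c hab hac hbc
    G.c6Hall_of_c6Complete hes

end PercRepro
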